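import Literature.Computability.AlgebraicComplexity.IK20HighestWeightVectors
import Literature.Computability.AlgebraicComplexity.IK2020ShiftLemmaProofs
import Literature.Computability.AlgebraicComplexity.BI17OddPlethysmColumnSets
import Literature.Computability.Complexity.OccurrenceObstructionsBIP
import HarnessLib

/-!
# Ikenmeyer–Kandasamy 2020, Cor. 4.5 (plethysm positivity) — proof

Discharge of the named fact `IK2020_cor_4_5` (`IK20HighestWeightVectors.lean`; cell `val-lit`,
row IK2020-A; honest framing: bookkeeping of a printed statement about the toy model
`p = x₁^D + ⋯ + x_m^D`; VP ≠ VNP is NOT proved and nothing here is progress on it).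

Printed statement (C. Ikenmeyer, U. Kandasamy, STOC 2020 = arXiv:1911.03990, Cor. 4.5, TeX
L483–488): "Let `D ≥ 3` be odd and let `m` be arbitrary with `binom(2(D-1), D-1) ≥ 2(m-1)`. Let `d`
be arbitrary. Let `e = 2⌈d/(2(D-2))⌉`. Then `a_{(dD)+m×eD}(d+me, D) ≥ 1`." As typed:
`1 ≤ plethysmCoeffOfPartition ℂ m D ((dD) + (m × eD))` (standing hypothesis `D ≤ m`).

## Proof (theorems only; no definitions, no named facts)

The printed proof applies the Main Technical Theorem 4.2 with `Ξ = {(d)}`. We do NOT use Thm. 4.2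
(an open named fact of the tree); instead we use the mechanism of IK's own §13 (TeX L1160–1175,
held text p0019: "given two highest weight vectors `f` of weight `λ` and `f̃` of weight `λ̃` … their
product `f · f̃` is nonzero and a highest weight vector of weight `λ + λ̃`", applied there to powers
of the Bürgisser–Ikenmeyer fundamental invariant `Φ` of degree `2m`, "`Φ(gp) = det(g)^{2D}` if `D`
is odd and `2m ≤ binom(2D, D)`"), which for `Ξ = {(d)}` needs no tableau lifting at all:

* `X_{x_m^D}^d` is a highest-weight vector of `ℂ[Sym^D ℂ^m]` of the dual weight `(dD)^*`
  (tree `X_mem_highestWeightSpace_coordRep`, `pow_mem_highestWeightSpace_coordRep`);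
* the tableau function `P_T` of BI 2017, proof of Prop. 3.24 (2) (tree
  `exists_tableau_aeval_psum_eq_factorial`: `P_T(x₁^D + ⋯ + x_m^D) = m!`, available when
  `2m ≤ binom(2D, D)`, which follows from the printed hypothesis `2(m-1) ≤ binom(2(D-1), D-1)` by
  Pascal's rule) is a homogeneous `SL_m`-invariant of degree `2m`
  (`tableauInvPoly_mem_slInvariantsOfDegree`), hence a highest-weight vector of the rectangular dual
  weight `((2D)^m)^* = (-2D, …, -2D)` (`slInvariantsOfDegree_le_highestWeightSpace`);
* the product `X_{x_m^D}^d · P_T^{e/2}` is a nonzero (polynomial ring = domain) highest-weight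
  vector (`mul_mem_highestWeightSpace_coordRep`) of weight `(dD)^* + (e/2)·((2D)^m)^* =
  ((dD) + (m × eD))^*` (t08's `IK2020.ofPartition_addRect`), so the highest-weight space of that
  weight — whose dimension is the plethysm coefficient — is nonzero.

## References

* C. Ikenmeyer, U. Kandasamy, STOC 2020 = arXiv:1911.03990, Cor. 4.5 and §13. [IkenmeyerKandasamy2019]
* P. Bürgisser, C. Ikenmeyer, J. Algebra 477 (2017), Prop. 3.24 (2) and its proof.
  [BurgisserIkenmeyer2017]
-/

noncomputable section

open MvPolynomial
open scoped BigOperators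

namespace Literature.Computability.AlgebraicComplexity

open _root_.Literature.NumberTheory.DiophantineGeometry
open _root_.Literature.Computability.Complexity
open IK2020

/-! ### §1 Arithmetic: the binomial hypothesis of Cor. 4.5 gives BI's `2m ≤ binom(2D, D)` -/

/-- From IK's hypothesis `2(m-1) ≤ binom(2(D-1), D-1)` (with `3 ≤ D ≤ m`) to BI 2017's
`2m ≤ binom(2D, D)`: by Pascal's rule `binom(2D, D) ≥ 2 binom(2D-2, D-1)` (private arithmetic
helper). [folklore] -/
private theorem two_mul_le_choose_of_le_choose_pred {m D : ℕ} (hD : 3 ≤ D) (hm : D ≤ m)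
    (h : 2 * (m - 1) ≤ Nat.choose (2 * (D - 1)) (D - 1)) : 2 * m ≤ Nat.choose (2 * D) D := by
  obtain ⟨D', rfl⟩ : ∃ D', D = D' + 1 := ⟨D - 1, by omega⟩
  simp only [Nat.add_sub_cancel] at h
  have hP : Nat.choose (2 * (D' + 1)) (D' + 1) =
      Nat.choose (2 * D' + 1) D' + Nat.choose (2 * D' + 1) (D' + 1) := by
    rw [show 2 * (D' + 1) = (2 * D' + 1) + 1 by ring, Nat.choose_succ_succ]
  have hS : Nat.choose (2 * D' + 1) (D' + 1) = Nat.choose (2 * D' + 1) D' :=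
    Nat.choose_symm_half D'
  have hP2 : Nat.choose (2 * D' + 1) (D' + 1) =
      Nat.choose (2 * D') D' + Nat.choose (2 * D') (D' + 1) := Nat.choose_succ_succ _ _
  omega

/-! ### §2 Weights: the dual weight of `λ + (m × ℓ)` and of a one-row partition -/

/-- The sorted parts of the one-row partition `(n)`: `n` in row `0`, nothing below (also for
`n = 0`; private helper). [folklore] -/
private theorem getD_sortedParts_indiscrete_eq_ite (n r : ℕ) :
    (Nat.Partition.indiscrete n).sortedParts.getD r 0 = if r = 0 then n else 0 := by
  rcases Nat.eq_zero_or_pos n with rfl | hn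
  · have h0 : (Nat.Partition.indiscrete 0).sortedParts = [] := by
      rw [← List.length_eq_zero_iff, Nat.Partition.length_sortedParts,
        Nat.Partition.partition_zero_parts, Multiset.card_zero]
    simp [h0]
  · have h1 : (Nat.Partition.indiscrete n).sortedParts = [n] := by
      simp [Nat.Partition.sortedParts, Nat.Partition.indiscrete_parts hn.ne']
    rw [h1]
    cases r <;> simp

/-- **The dual weight of `λ + (m × ℓ)` is `λ^* - (ℓ, …, ℓ)`** (IK §3, TeX L312–313; from t08's
`IK2020.ofPartition_addRect`). [cite: IkenmeyerKandasamy2019, §3] -/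
theorem dualOfPartition_addRect {n : ℕ} (lam : Nat.Partition n) (m ℓ : ℕ)
    (h : lam.parts.card ≤ m) :
    Weight.dualOfPartition m (addRect lam m ℓ h) =
      fun i => Weight.dualOfPartition m lam i - (ℓ : ℤ) := by
  funext i
  show -(Weight.ofPartition m (addRect lam m ℓ h) (Fin.rev i)) =
    -(Weight.ofPartition m lam (Fin.rev i)) - (ℓ : ℤ)
  rw [ofPartition_addRect]
  ring

/-- The dual weight of the one-row partition `(n)` for `GL_m` (`m ≥ 1`) is `-n ε_{m-1}`, i.e.
`(0, …, 0, -n)` (private helper). [folklore] -/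
private theorem dualOfPartition_indiscrete_apply {m : ℕ} (n : ℕ) (i : Fin m) :
    Weight.dualOfPartition m (Nat.Partition.indiscrete n) i =
      if (i : ℕ) = m - 1 then -(n : ℤ) else 0 := by
  show -(Weight.ofPartition m (Nat.Partition.indiscrete n) (Fin.rev i)) = _
  rw [Weight.ofPartition_apply, getD_sortedParts_indiscrete_eq_ite, Fin.val_rev]
  have hi := i.2
  by_cases h : (i : ℕ) = m - 1
  · rw [if_pos (by omega), if_pos h]
  · rw [if_neg (by omega), if_neg h, Nat.cast_zero, neg_zero]

/-! ### §3 The discharge -/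

/-- **Ikenmeyer–Kandasamy 2020, Cor. 4.5 — the named fact `IK2020_cor_4_5` holds** (TeX L483–488):
for `D ≥ 3` odd, `D ≤ m`, `2(m-1) ≤ binom(2(D-1), D-1)` and any `d`, with `e = 2⌈d/(2(D-2))⌉`,
the plethysm coefficient `a_{(dD)+(m×eD)}(d+me, D)` is positive. Proof by the semigroup of
highest-weight vectors of `ℂ[Sym^D ℂ^m]`: `X_{x_m^D}^d · P_T^{e/2} ≠ 0` with `P_T` BI 2017's tableau
`SL_m`-invariant of degree `2m` (module docstring). [cite: IkenmeyerKandasamy2019, Cor. 4.5] -/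
theorem IK2020_cor_4_5_holds : IK2020_cor_4_5 := by
  intro m d D hD hDodd hm hbinom
  classical
  have hm0 : 0 < m := by omega
  have hD0 : 0 < D := by omega
  have h2m : 2 * m ≤ Nat.choose (2 * D) D := two_mul_le_choose_of_le_choose_pred hD hm hbinom
  have h2D : D * (2 * m) / m = 2 * D := by
    rw [← mul_assoc, Nat.mul_div_cancel _ hm0, mul_comm]
  -- the greatest variable `x_{m-1}`
  let iₘ : Fin m := ⟨m - 1, by omega⟩
  have hiₘ : ∀ i : Fin m, i ≤ iₘ := fun i => Fin.le_def.mpr (by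
    have := i.2
    show (i : ℕ) ≤ m - 1
    omega)
  -- HWV 1: the coordinate `X_{x_{m-1}^D}` and its `d`-th power
  let e : DegIdx (Fin m) D :=
    ⟨Finsupp.single iₘ D, mem_degMonomials_iff.mpr (Finsupp.degree_single _ _)⟩
  have hX : (X e : MvPolynomial (DegIdx (Fin m) D) ℂ) ∈
      highestWeightSpace (coordRep (Fin m) ℂ D) (Pi.single iₘ (-(D : ℤ))) :=
    X_mem_highestWeightSpace_coordRep D iₘ hiₘ e rfl
  have hXd := pow_mem_highestWeightSpace_coordRep hX d
  -- HWV 2: BI 2017's tableau invariant of degree `2m`, and its `⌈d/(2(D-2))⌉`-th power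
  obtain ⟨β, hβ⟩ := exists_tableau_aeval_psum_eq_factorial (k := ℂ) (m := m) hD0 h2m
  have hPsl := tableauInvPoly_mem_slInvariantsOfDegree (k := ℂ) β
  have hP : tableauInvPoly (k := ℂ) D β id ∈
      highestWeightSpace (coordRep (Fin m) ℂ D) (fun _ : Fin m => -((D * (2 * m) / m : ℕ) : ℤ)) :=
    slInvariantsOfDegree_le_highestWeightSpace hm0 ⟨2 * D, by ring⟩ hPsl
  have hPc := pow_mem_highestWeightSpace_coordRep hP (ceilDiv d (2 * (D - 2)))
  -- the product
  have hF := mul_mem_highestWeightSpace_coordRep hXd hPc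
  have hP0 : tableauInvPoly (k := ℂ) D β id ≠ 0 := by
    intro h0
    rw [h0, map_zero] at hβ
    exact Nat.cast_ne_zero.mpr (Nat.factorial_ne_zero m) hβ.symm
  have hF0 : (X e : MvPolynomial (DegIdx (Fin m) D) ℂ) ^ d *
      (tableauInvPoly (k := ℂ) D β id) ^ (ceilDiv d (2 * (D - 2))) ≠ 0 :=
    mul_ne_zero (pow_ne_zero _ (X_ne_zero e)) (pow_ne_zero _ hP0)
  -- the weight of the product is `((dD) + (m × eD))^*`
  have hW : ∀ h, Weight.dualOfPartition m (addRect (Nat.Partition.indiscrete (d * D)) m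
      (2 * ceilDiv d (2 * (D - 2)) * D) h) =
      d • (Pi.single iₘ (-(D : ℤ)) : Weight (Fin m)) +
        ceilDiv d (2 * (D - 2)) • (fun _ : Fin m => -((D * (2 * m) / m : ℕ) : ℤ)) := by
    intro h
    rw [dualOfPartition_addRect]
    funext i
    rw [dualOfPartition_indiscrete_apply, Pi.add_apply, Pi.smul_apply, Pi.smul_apply, h2D]
    by_cases hi : (i : ℕ) = m - 1
    · have hi' : i = iₘ := Fin.ext hi
      rw [if_pos hi, hi', Pi.single_eq_same]
      simp only [Nat.cast_mul, Nat.cast_ofNat]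
      ring
    · have hi' : i ≠ iₘ := fun h' => hi (by rw [h'])
      rw [if_neg hi, Pi.single_eq_of_ne hi']
      simp only [smul_zero, Nat.cast_mul, Nat.cast_ofNat]
      ring
  -- conclusion: a nonzero vector in a finite-dimensional highest-weight space
  unfold plethysmCoeffOfPartition
  rw [hW]
  haveI := finiteDimensional_highestWeightSpace_coordRep_holds (k := ℂ) (σ := Fin m) hD0.ne'
    (d • (Pi.single iₘ (-(D : ℤ)) : Weight (Fin m)) +
      ceilDiv d (2 * (D - 2)) • (fun _ : Fin m => -((D * (2 * m) / m : ℕ) : ℤ)))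
  rw [plethysmCoeff, hwMultiplicity, Nat.one_le_iff_ne_zero, Ne, Submodule.finrank_eq_zero]
  intro hbot
  rw [hbot, Submodule.mem_bot] at hF
  exact hF0 hF

end Literature.Computability.AlgebraicComplexity
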